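import Summits.AtomisticToContinuum.HydrodynamicLimit.Theorems.JParityClosureLocalSecondLawEquilibriumColdBallsFrozenBound
import Summits.AtomisticToContinuum.HydrodynamicLimit.Theorems.JParityClosureLocalSecondLawEquilibriumColdBallsTransfer
import Summits.AtomisticToContinuum.HydrodynamicLimit.Theorems.JParityClosureLocalSecondLawEquilibriumColdBallsLimits
import Summits.AtomisticToContinuum.HydrodynamicLimit.Theorems.JParityClosureLocalSecondLawEquilibriumOneParticleMarginal

/-!
# Cold balls (lead c3): assembly of the registered equilibrium stub `eq_coldBalls`

Crux `JParityClosure.LocalSecondLaw` (stmt-AtomisticToContinuum-13081), line `exact-entropy-ledger-three-passivities`, equilibrium side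
composition.  `eq_coldBalls_of`: the frozen-position bound, the shell domination, the shell volumes, the uniform one-particle marginal
and the two elementary limits give `sup_{Φ, x} E[coldTerm] → 0` as `N → ∞` at fixed `r` (rung-0 disintegration + union bound + Tannery);
`eq_coldBalls` (registered signature, verbatim) instantiates it with `coldBalls_frozen_shells`, `volume_shell_le`,
`uniformMarginal_localGibbsLaw_const` (the uniform one-particle marginal, `…OneParticleMarginal`), `coldBalls_tendsto_logpow_div_sqrt`,
`tendsto_tsum_shells`.

References: H. Spohn, *Large Scale Dynamics of Interacting Particles* (1991), Part I §2.3 (homogeneous Gibbs law: configurational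
Gibbs measure ⊗ product Maxwellian); S. Goldstein, J. L. Lebowitz, Physica D 193 (2004) 53–66 (typicality of coarse-grained
observables at equilibrium).
-/

noncomputable section

namespace Summit.AtomisticToContinuum.HydrodynamicLimit.Theorems.LocalSecondLawEquilibrium

open scoped BigOperators Topology Classical MeasureTheory ENNReal InnerProductSpace
open Filter Set MeasureTheory ProbabilityTheory
open Literature.MathematicalPhysics.KineticTheory
open Literature.Analysis.FluidPDE
open Summit.AtomisticToContinuum.HydrodynamicLimit.Theorems.LocalSecondLawNegative
open Summit.AtomisticToContinuum.HydrodynamicLimit.Theorems.LocalSecondLawLedger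
open Summit.AtomisticToContinuum.HydrodynamicLimit.Theorems.LocalSecondLawLedger.L
open ColdFrozen

variable {N : ℕ}

/-! ## The assembly -/

/-- **Assembly of the cold-ball stub** (`eq_coldBalls`) from its registered parts, abstractly: a frozen-position bound of the
velocity integral by the singleton term `B/(N+1)`, the spread term `B/(2√(N+1))·(S_I(Θ,N) + c)` and a dominated term `X`
(`coldBalls_frozen`), the shell domination of `X` (`dominated_le_tsum`), the shell volumes, the uniform one-particle marginal
(`eq_uniformMarginal`) and the two elementary limits (`coldBalls_tendsto_logpow_div_sqrt`, `tendsto_tsum_shells`) give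
`sup_{Φ, x} E[coldTerm] → 0` as `N → ∞` at fixed `r` (rung-0 disintegration of the homogeneous law + union bound + Tannery). -/
theorem eq_coldBalls_of {a Θ σ r : ℝ} {ū : V3} (ha : 0 < a) (hΘ : 0 < Θ) (hσhalf : σ ≤ 1 / 2) (hr : 0 < r)
    {cC cS : ℝ} (hcS : 0 ≤ cS) (X : (N : ℕ) → (Fin (N + 1) → T3) → T3 → ℝ≥0∞)
    (hFrozen : ∀ (N : ℕ) (xs : Fin (N + 1) → T3) (x₀ : T3),
      ∫⁻ vs, ENNReal.ofReal (coldStat Θ r xs x₀ vs) ∂Measure.pi (fun _ : Fin (N + 1) => gaussMeasure ū Θ) ≤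
        ENNReal.ofReal (3 / (Real.pi * r ^ 3) / ((N + 1 : ℕ) : ℝ)) +
          ENNReal.ofReal (3 / (Real.pi * r ^ 3) / (2 * Real.sqrt ((N + 1 : ℕ) : ℝ)) * (coldSI Θ N + cC)) + X N xs x₀)
    (hDom : ∀ (N : ℕ) (xs : Fin (N + 1) → T3) (x₀ : T3), X N xs x₀ ≤
      ∑' m : ℕ, ENNReal.ofReal (coldII Θ r N (3 / (Real.pi * r ^ 3) * (2 : ℝ)⁻¹ ^ (m + 1))) *
        {xs : Fin (N + 1) → T3 | ∃ k, xs k ∈ {y : T3 | 3 / (Real.pi * r ^ 3) * (2 : ℝ)⁻¹ ^ (m + 1) < cone r y x₀ ∧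
          cone r y x₀ ≤ 3 / (Real.pi * r ^ 3) * (2 : ℝ)⁻¹ ^ m}}.indicator 1 xs)
    (hShell : ∀ (m : ℕ) (x₀ : T3), volume {y : T3 | 3 / (Real.pi * r ^ 3) * (2 : ℝ)⁻¹ ^ (m + 1) < cone r y x₀ ∧
          cone r y x₀ ≤ 3 / (Real.pi * r ^ 3) * (2 : ℝ)⁻¹ ^ m} ≤ ENNReal.ofReal (cS * (2 : ℝ)⁻¹ ^ m))
    (hMarg : ∀ (N : ℕ) (Φ : Flow σ N) (f : T3 → ℝ≥0∞), Measurable f →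
      ∫⁻ z, ∑ i : Fin (N + 1), f (z i).1 ∂(lawC σ a Θ ū N Φ) = ((N + 1 : ℕ) : ℝ≥0∞) * ∫⁻ y : T3, f y)
    (hlim1 : ∀ (A C κ : ℝ), 0 ≤ A → 0 ≤ C → 0 < κ → Tendsto (fun N : ℕ =>
      (A + C * (max 0 (Real.log (κ * ((N + 1 : ℕ) : ℝ) ^ 2))) ^ 4) / Real.sqrt ((N + 1 : ℕ) : ℝ)) atTop (𝓝 0))
    (hlim2 : ∀ (p q c κ : ℝ), 0 ≤ p → 0 ≤ q → 0 ≤ c → 0 < κ → Tendsto (fun N : ℕ =>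
      ∑' m : ℕ, (p + q * (max 0 (Real.log (κ * 2 ^ (m + 1)))) ^ 2) * min (((N + 1 : ℕ) : ℝ)⁻¹) (c * (2 : ℝ)⁻¹ ^ m))
        atTop (𝓝 0)) :
    ∀ ε : ℝ, 0 < ε → ∃ N₀ : ℕ, ∀ N : ℕ, N₀ ≤ N → ∀ (Φ : Flow σ N) (x : T3),
      ∫⁻ w, ENNReal.ofReal (coldTerm Θ r w x) ∂(lawC σ a Θ ū N Φ) ≤ ENNReal.ofReal ε := by
  intro ε hε
  set B : ℝ := 3 / (Real.pi * r ^ 3) with hB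
  have hB0 : 0 < B := by positivity
  have hD := coldD_nonneg hΘ.le
  have hc0 := coldC0_pos Θ
  -- the three vanishing real sequences
  have hnat : Tendsto (fun N : ℕ => ((N + 1 : ℕ) : ℝ)) atTop atTop :=
    tendsto_natCast_atTop_atTop.comp (tendsto_add_atTop_nat 1)
  have hsq : Tendsto (fun N : ℕ => Real.sqrt ((N + 1 : ℕ) : ℝ)) atTop atTop := Real.tendsto_sqrt_atTop.comp hnat
  have t1 : Tendsto (fun N : ℕ => B / ((N + 1 : ℕ) : ℝ)) atTop (𝓝 0) := tendsto_const_nhds.div_atTop hnat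
  have t2 : Tendsto (fun N : ℕ => B / (2 * Real.sqrt ((N + 1 : ℕ) : ℝ)) * (coldSI Θ N + cC)) atTop (𝓝 0) := by
    have hA : 0 ≤ 3 * coldC0 Θ ^ 2 + 768 * (64 * coldD Θ) := by positivity
    have h1 := hlim1 (3 * coldC0 Θ ^ 2 + 768 * (64 * coldD Θ)) 48 (3 * Θ) hA (by norm_num) (by positivity)
    have h2 : Tendsto (fun N : ℕ => cC / Real.sqrt ((N + 1 : ℕ) : ℝ)) atTop (𝓝 0) := tendsto_const_nhds.div_atTop hsq
    have h3 := (h1.add h2).const_mul (B / 2)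
    rw [add_zero, mul_zero] at h3
    refine h3.congr' (Eventually.of_forall fun N => ?_)
    have hs : 0 < Real.sqrt ((N + 1 : ℕ) : ℝ) := Real.sqrt_pos.2 (by positivity)
    simp only [coldSI]
    field_simp
    ring
  have t3 := hlim2 (2 * B * (coldC0 Θ + 16 * (1 + 64 * coldD Θ))) (2 * B * 4) cS (6 * Θ)
    (by positivity) (by positivity) hcS (by positivity)
  -- thresholds
  have hε3 : 0 < ε / 3 := by positivity
  obtain ⟨N₁, hN₁⟩ := eventually_atTop.1 (t1.eventually (gt_mem_nhds hε3))
  obtain ⟨N₂, hN₂⟩ := eventually_atTop.1 (t2.eventually (gt_mem_nhds hε3))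
  obtain ⟨N₃, hN₃⟩ := eventually_atTop.1 (t3.eventually (gt_mem_nhds hε3))
  refine ⟨max N₁ (max N₂ N₃), fun N hN Φ x => ?_⟩
  have h1 := hN₁ N ((le_max_left _ _).trans hN)
  have h2 := hN₂ N (((le_max_left _ _).trans (le_max_right _ _)).trans hN)
  have h3 := hN₃ N (((le_max_right _ _).trans (le_max_right _ _)).trans hN)
  -- the laws
  set Pos : Measure (Fin (N + 1) → T3) := posGibbsMeasure (fun _ : T3 => a) (hsDiameter σ N) (N + 1) with hPos
  set Q : Measure (Fin (N + 1) → V3) := Measure.pi fun _ : Fin (N + 1) => gaussMeasure ū Θ with hQ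
  haveI : IsProbabilityMeasure Pos := isProbabilityMeasure_posGibbsMeasure continuous_const (fun _ => ha) hσhalf N
  -- the shells and the real shell series at this N
  set S : ℕ → Set T3 := fun m => {y : T3 | B * (2 : ℝ)⁻¹ ^ (m + 1) < cone r y x ∧ cone r y x ≤ B * (2 : ℝ)⁻¹ ^ m}
    with hS
  have hSm : ∀ m, MeasurableSet (S m) := fun m => measurableSet_shell r m x
  set g : ℕ → ℝ := fun m => 2 * B * (coldC0 Θ + 16 * (1 + 64 * coldD Θ)) +
      2 * B * 4 * (max 0 (Real.log (6 * Θ * 2 ^ (m + 1)))) ^ 2 with hg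
  set t : ℕ → ℝ := fun m => g m * min (((N + 1 : ℕ) : ℝ)⁻¹) (cS * (2 : ℝ)⁻¹ ^ m) with ht
  have hg0 : ∀ m, 0 ≤ g m := fun m => by positivity
  have ht0 : ∀ m, 0 ≤ t m := fun m => mul_nonneg (hg0 m) (le_min (by positivity) (by positivity))
  have hsum : Summable t := by
    refine Summable.of_nonneg_of_le ht0 (fun m => mul_le_mul_of_nonneg_left (min_le_right _ _) (hg0 m)) ?_
    exact summable_shellMajorant (p := 2 * B * (coldC0 Θ + 16 * (1 + 64 * coldD Θ))) (q := 2 * B * 4) (c := cS)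
      (by positivity : (0 : ℝ) < 6 * Θ)
  -- step 1: rung-0 disintegration (coldStat is coldTerm ∘ zipConfig by definition)
  have hdis : ∫⁻ w, ENNReal.ofReal (coldTerm Θ r w x) ∂(lawC σ a Θ ū N Φ) =
      ∫⁻ xs, ∫⁻ vs, ENNReal.ofReal (coldStat Θ r xs x vs) ∂Q ∂Pos := by
    rw [lintegral_lawC_eq_prod ū ha hΘ N Φ (measurable_coldTerm Θ r x).ennreal_ofReal]
    rfl
  rw [hdis]
  -- step 2: the per-shell terms
  have hper : ∀ m : ℕ, ENNReal.ofReal (coldII Θ r N (B * (2 : ℝ)⁻¹ ^ (m + 1))) *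
      ∫⁻ xs, {xs : Fin (N + 1) → T3 | ∃ k, xs k ∈ S m}.indicator 1 xs ∂Pos ≤ ENNReal.ofReal (t m) := by
    intro m
    have hocc := lintegral_exists_mem_le ū ha hΘ hσhalf N Φ (hMarg N Φ) (hSm m)
    have hx0 : 0 ≤ ((N + 1 : ℕ) : ℝ) * (cS * (2 : ℝ)⁻¹ ^ m) := by positivity
    have hvol : min 1 (((N + 1 : ℕ) : ℝ≥0∞) * volume (S m)) ≤
        ENNReal.ofReal (min 1 (((N + 1 : ℕ) : ℝ) * (cS * (2 : ℝ)⁻¹ ^ m))) := by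
      rcases le_total 1 (((N + 1 : ℕ) : ℝ) * (cS * (2 : ℝ)⁻¹ ^ m)) with hle | hle
      · rw [min_eq_left hle, ENNReal.ofReal_one]; exact min_le_left _ _
      · rw [min_eq_right hle]
        refine (min_le_right _ _).trans ?_
        rw [ENNReal.ofReal_mul (by positivity), ENNReal.ofReal_natCast]
        exact mul_le_mul_right (hShell m x) _
    have hII0 : 0 ≤ coldII Θ r N (B * (2 : ℝ)⁻¹ ^ (m + 1)) := by unfold coldII; positivity
    have halg : coldII Θ r N (B * (2 : ℝ)⁻¹ ^ (m + 1)) * min 1 (((N + 1 : ℕ) : ℝ) * (cS * (2 : ℝ)⁻¹ ^ m)) = t m := by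
      have hn : (0 : ℝ) < ((N + 1 : ℕ) : ℝ) := by positivity
      have hlogarg : 6 * Θ * (3 / (Real.pi * r ^ 3)) / (B * (2 : ℝ)⁻¹ ^ (m + 1)) = 6 * Θ * 2 ^ (m + 1) := by
        rw [hB, inv_pow]; field_simp
      have hmin := inv_mul_min_one N (cS * (2 : ℝ)⁻¹ ^ m)
      simp only [ht, hg, coldII, hlogarg]
      rw [← hmin, hB]
      ring
    calc ENNReal.ofReal (coldII Θ r N (B * (2 : ℝ)⁻¹ ^ (m + 1))) *
          ∫⁻ xs, {xs : Fin (N + 1) → T3 | ∃ k, xs k ∈ S m}.indicator 1 xs ∂Pos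
        ≤ ENNReal.ofReal (coldII Θ r N (B * (2 : ℝ)⁻¹ ^ (m + 1))) *
            ENNReal.ofReal (min 1 (((N + 1 : ℕ) : ℝ) * (cS * (2 : ℝ)⁻¹ ^ m))) := mul_le_mul_right (hocc.trans hvol) _
      _ = ENNReal.ofReal (t m) := by rw [← ENNReal.ofReal_mul hII0, halg]
  -- step 3: the dominated term, integrated over positions
  have hX : ∫⁻ xs, X N xs x ∂Pos ≤ ENNReal.ofReal (∑' m, t m) := by
    calc ∫⁻ xs, X N xs x ∂Pos
        ≤ ∫⁻ xs, ∑' m : ℕ, ENNReal.ofReal (coldII Θ r N (B * (2 : ℝ)⁻¹ ^ (m + 1))) *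
            {xs : Fin (N + 1) → T3 | ∃ k, xs k ∈ S m}.indicator 1 xs ∂Pos := lintegral_mono fun xs => hDom N xs x
      _ = ∑' m : ℕ, ∫⁻ xs, ENNReal.ofReal (coldII Θ r N (B * (2 : ℝ)⁻¹ ^ (m + 1))) *
            {xs : Fin (N + 1) → T3 | ∃ k, xs k ∈ S m}.indicator 1 xs ∂Pos := by
          refine lintegral_tsum fun m => ?_
          have hmeas : MeasurableSet {xs : Fin (N + 1) → T3 | ∃ k, xs k ∈ S m} := by
            have : {xs : Fin (N + 1) → T3 | ∃ k, xs k ∈ S m} = ⋃ k, {xs | xs k ∈ S m} := by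
              ext xs; simp
            rw [this]
            exact MeasurableSet.iUnion fun k => measurable_pi_apply k (hSm m)
          exact (measurable_const.mul (measurable_one.indicator hmeas)).aemeasurable
      _ = ∑' m : ℕ, ENNReal.ofReal (coldII Θ r N (B * (2 : ℝ)⁻¹ ^ (m + 1))) *
            ∫⁻ xs, {xs : Fin (N + 1) → T3 | ∃ k, xs k ∈ S m}.indicator 1 xs ∂Pos := by
          refine tsum_congr fun m => ?_
          rw [lintegral_const_mul' _ _ ENNReal.ofReal_ne_top]
      _ ≤ ∑' m : ℕ, ENNReal.ofReal (t m) := ENNReal.tsum_le_tsum hper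
      _ = ENNReal.ofReal (∑' m, t m) := (ENNReal.ofReal_tsum_of_nonneg ht0 hsum).symm
  -- step 4: frozen estimate integrated over positions, and the budget
  calc ∫⁻ xs, ∫⁻ vs, ENNReal.ofReal (coldStat Θ r xs x vs) ∂Q ∂Pos
      ≤ ∫⁻ xs, (ENNReal.ofReal (B / ((N + 1 : ℕ) : ℝ)) +
          ENNReal.ofReal (B / (2 * Real.sqrt ((N + 1 : ℕ) : ℝ)) * (coldSI Θ N + cC)) + X N xs x) ∂Pos :=
        lintegral_mono fun xs => hFrozen N xs x
    _ = ENNReal.ofReal (B / ((N + 1 : ℕ) : ℝ)) +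
          ENNReal.ofReal (B / (2 * Real.sqrt ((N + 1 : ℕ) : ℝ)) * (coldSI Θ N + cC)) + ∫⁻ xs, X N xs x ∂Pos := by
        rw [lintegral_add_left measurable_const, lintegral_const, measure_univ, mul_one]
    _ ≤ ENNReal.ofReal (ε / 3) + ENNReal.ofReal (ε / 3) + ENNReal.ofReal (ε / 3) := by
        refine add_le_add (add_le_add (ENNReal.ofReal_le_ofReal h1.le) (ENNReal.ofReal_le_ofReal h2.le))
          (hX.trans (ENNReal.ofReal_le_ofReal h3.le))
    _ = ENNReal.ofReal ε := by
        rw [← ENNReal.ofReal_add hε3.le hε3.le, ← ENNReal.ofReal_add (by positivity) hε3.le]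
        congr 1; ring


/-- **Registered stub `eq_coldBalls`** (line `exact-entropy-ledger-three-passivities`, equilibrium side composition): under the
homogeneous local Gibbs law the cold-populated-ball statistic `coldTerm = ρ_r(1 + log²θ_r)·cutTheta Θ θ_r` has expectation `→ 0`
as `N → ∞` at fixed `r`, uniformly in the flow and the field point. -/
theorem eq_coldBalls : ∀ (a Θ σ r : ℝ) (ū : V3), 0 < a → 0 < Θ → 0 < σ → σ ≤ 1 / 2 → 0 < r → r < 1 / 2 → ∀ ε : ℝ, 0 < ε → ∃ N₀ : ℕ, ∀ N : ℕ, N₀ ≤ N → ∀ (Φ : Flow σ N) (x : T3), ∫⁻ w, ENNReal.ofReal (coldTerm Θ r w x) ∂(lawC σ a Θ ū N Φ) ≤ ENNReal.ofReal ε := by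
  intro a Θ σ r ū ha hΘ hσ hσhalf hr hrhalf
  exact eq_coldBalls_of ha hΘ hσhalf hr (cC := chebConst Θ ū) (cS := 2 * Real.pi * r ^ 3) (by positivity)
    (fun N xs x₀ => ∑' m : ℕ, ENNReal.ofReal (coldII Θ r N (3 / (Real.pi * r ^ 3) * (2 : ℝ)⁻¹ ^ (m + 1))) *
        {xs : Fin (N + 1) → T3 | ∃ k, xs k ∈ {y : T3 | 3 / (Real.pi * r ^ 3) * (2 : ℝ)⁻¹ ^ (m + 1) < cone r y x₀ ∧
          cone r y x₀ ≤ 3 / (Real.pi * r ^ 3) * (2 : ℝ)⁻¹ ^ m}}.indicator 1 xs)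
    (fun N xs x₀ => coldBalls_frozen_shells hΘ hr ū N xs x₀) (fun N xs x₀ => le_rfl)
    (fun m x₀ => volume_shell_le hr hrhalf m x₀) (fun N Φ f hf => uniformMarginal_localGibbsLaw_const a Θ σ ū ha hΘ hσ hσhalf N Φ f hf)
    coldBalls_tendsto_logpow_div_sqrt (fun p q c κ hp hq hc hκ => tendsto_tsum_shells hp hq hc hκ)

end Summit.AtomisticToContinuum.HydrodynamicLimit.Theorems.LocalSecondLawEquilibrium

end
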